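import Literature.NumberTheory.EllipticCurves.NeronModelOnePrimeGlue
import Literature.AlgebraicGeometry.Limits.LocalizationIsoSpread
import Literature.RingTheory.DedekindDomain.GenericPointAtPrime
import HarnessLib

/-!
# Néron models at one bad prime: reduction to a model of the local Néron model near `𝔭`

Eighth file of the existence programme for Néron models
(`Literature.NumberTheory.EllipticCurves.NeronModelExistence`; gluing leaf
`exists_isNeronModel_of_away_of_atPrime`, reduced in `NeronModelGluing` to the one-bad-prime fact
`exists_isNeronModel_of_away_of_atPrime_of_unique` and the two-open-sets fact, the latter proved
in `NeronModelTwoOpens`). Here the one-bad-prime fact — *a `K`-group scheme with Néron models over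
`R[1/f]` and over `R_𝔭`, `𝔭` the only maximal ideal of the Dedekind domain `R` containing `f ≠ 0`,
has a Néron model over `R`* (Bosch–Lütkebohmert–Raynaud, *Néron Models*, §1.4) — is proved up to
one input of general scheme theory:

* `exists_isNeronModel_of_away_of_localModel` (**proved**): if moreover some smooth separated
  quasi-compact scheme `Y` over (a model of) `R[1/g]`, `g ∉ 𝔭`, becomes a Néron model of `E` over
  `R_𝔭` after base change — e.g. a model over `D(g)` of the Néron model over `R_𝔭` — then `E` has a
  Néron model over `R`. Proof: over `R_{fg} = R_f[1/g]` the schemes `Y ×_{R_g} R_{fg}` and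
  `N_f ×_{R_f} R_{fg}` (`N_f` the Néron model over `R_f = R[1/f]`) are quasi-compact, separated,
  smooth, with generic fibre `E`; `K` is the localization of `R_{fg}` at the image of `R ∖ 𝔭`
  (`Literature.RingTheory.DedekindDomain.isLocalization_map_primeCompl_of_away`), so they become
  isomorphic over `R_{fg}[1/w]` for some `w ∉ 𝔭`
  (`LocApprox.exists_pullback_iso_of_pullback_iso` of
  `Literature.AlgebraicGeometry.Limits.LocalizationIsoSpread`, Görtz–Wedhorn I Cor. 10.64 (2));
  then `Y ×_{R_g} R_g[1/w]` and `N_f` glue to a Néron model over `R`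
  (`exists_isNeronModel_of_iso_glue_atPrime` of `NeronModelOnePrimeGlue`, which uses the local
  criterion `NeronModelLocalCriterion`). Most of the text is the bookkeeping of the seven rings
  `R, R_f, R_g, R_{fg}, R_{fg}[1/w], R_g[1/w], R_𝔭` and their algebra structures.
* `exists_isNeronModel_of_away_of_atPrime_of_localModels` (**proved**): the one-bad-prime fact
  follows from the statement `hD` that smooth separated quasi-compact schemes over `R_𝔭` extend to
  such schemes over some `D(g) ∋ 𝔭` — EGA IV₃ Thm. 8.8.2 (ii) (schemes of finite presentation over
  `lim S_λ` come from some `S_λ`), Prop. 8.10.5 (v) (separatedness descends) and EGA IV₄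
  Prop. 17.7.8 (ii) (smoothness descends), for `Spec R_𝔭 = lim_{g ∉ 𝔭} Spec R[1/g]`
  (Görtz–Wedhorn I, Thm. 10.66 and (10.13)). This descent statement is taken as an explicit
  hypothesis: it is not in Mathlib (whose `Mathlib.AlgebraicGeometry.AffineTransitionLimit` has the
  morphism half, Stacks 01ZC, used throughout this programme, but not the descent of objects,
  Stacks 01ZM, nor of smoothness / separatedness) and it is deliberately **not** introduced as a
  named fact here; with it, `exists_isNeronModel_of_away_of_atPrime_of_unique` holds.

## References

* S. Bosch, W. Lütkebohmert, M. Raynaud, *Néron Models*, Springer 1990, §1.2 (Prop. 4), §1.4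
  (local-to-global passage over a Dedekind scheme). [BLRNeronModels1990]
* A. Grothendieck, EGA IV₃, Thm. 8.8.2, Prop. 8.10.5 (Publ. Math. IHÉS 28, 1966). [EGAIV3]
* A. Grothendieck, EGA IV₄, Prop. 17.7.8 (Publ. Math. IHÉS 32, 1967). [EGAIV4]
* U. Görtz, T. Wedhorn, *Algebraic Geometry I: Schemes*, 2nd ed. (2020), (10.13), Cor. 10.64,
  Thm. 10.66, pp. 321–330. [GortzWedhorn2020]
-/

noncomputable section

universe u

namespace Literature.NumberTheory.EllipticCurves

open _root_.AlgebraicGeometry CategoryTheory Limits MonoidalCategory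
open Literature.AlgebraicGeometry.Limits
open Literature.AlgebraicGeometry.Motives (SchemeOver specOver)
open scoped CategoryTheory.Obj

/-! ### Iterated base change along a factorisation -/

section Fac

variable {S S' T : Scheme.{u}} (φ : S' ⟶ S) (a' : T ⟶ S') (a : T ⟶ S) (ha : a' ≫ φ = a)

/-- `(Y ×_S S') ×_{S'} T ≅ Y ×_S T` for `a = a' ≫ φ : T → S' → S` (transitivity of base change,
`pullbackPullbackIso`, followed by the identification of the base changes along the equal
morphisms `a' ≫ φ` and `a`). [folklore] -/
def pullbackObjIsoOfFac (Y : Over S) :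
    (Over.pullback a').obj ((Over.pullback φ).obj Y) ≅ (Over.pullback a).obj Y :=
  pullbackPullbackIso φ a' Y ≪≫
    Over.isoMk (pullback.congrHom rfl ha) ((pullback.lift_snd _ _ _).trans (Category.comp_id _))

end Fac

/-! ### Néron model over `R` from a model of the local Néron model over a neighbourhood of `𝔭` -/

section OnePrime

variable {R : Type u} [CommRing R] [IsDedekindDomain R] {K : Type u} [Field K] [Algebra R K]
  [IsFractionRing R K] (E : Over (Spec (.of K))) [GrpObj E]

set_option maxHeartbeats 800000 in
/-- **Néron model over a Dedekind domain from the Néron model away from `𝔭` and a model, over an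
open neighbourhood of `𝔭`, of the Néron model at `𝔭`** (the local-to-global passage of
Bosch–Lütkebohmert–Raynaud, *Néron Models*, §1.4, at one closed point, granted the model). Let
`R` be a Dedekind domain with fraction field `K`, `E` a `K`-group scheme, `0 ≠ f ∈ 𝔭` with `𝔭` the
only maximal ideal containing `f`, and suppose `E` has Néron models over the models of `R[1/f]`
(`HasNeronModelAway`). Let `g ∉ 𝔭`, `R_g`, `R_𝔭` models of `R[1/g]` and of the local ring at `𝔭`
(compatibly mapping to `K`), and let `Y → Spec R_g` be smooth, separated and quasi-compact such
that `Y ×_{R_g} R_𝔭` is a Néron model of `E` over `R_𝔭` (group-free sense). Then `E` has a Néron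
model over `R`. Proof: over the model `R_{fg} = R_f[1/g]` of `R[1/fg]`, both `Y ×_{R_g} R_{fg}` and
`N_f ×_{R_f} R_{fg}` (`N_f` the Néron model over `R_f = R[1/f]`) are quasi-compact, separated and
smooth with generic fibre `E`; since `K` is the localization of `R_{fg}` at the image of `R ∖ 𝔭`
(`isLocalization_map_primeCompl_of_away`: `Spec K = lim_{w ∉ 𝔭} D(fgw)`), they become isomorphic
over `R_{fg}[1/w]` for some `w ∉ 𝔭` (`LocApprox.exists_pullback_iso_of_pullback_iso`,
Görtz–Wedhorn I Cor. 10.64); glue `Y ×_{R_g} R_g[1/w]` and `N_f` along this isomorphism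
(`exists_isNeronModel_of_iso_glue_atPrime`). With the existence of such a model `Y` of the local
Néron model (EGA IV₃ 8.8.2 (ii), 8.10.5 (v), IV₄ 17.7.8 (ii): schemes of finite presentation,
separatedness and smoothness descend along `R_𝔭 = colim_{g ∉ 𝔭} R[1/g]`) this is the one-bad-prime
gluing fact `exists_isNeronModel_of_away_of_atPrime_of_unique` of `NeronModelGluing`.
[cite: BLRNeronModels1990, §1.4 (local-to-global passage, one closed point)] -/
theorem exists_isNeronModel_of_away_of_localModel (f : R) (hf : f ≠ 0) (p : Ideal R)
    [p.IsMaximal] (hfp : f ∈ p) (huniq : ∀ q : Ideal R, q.IsMaximal → f ∈ q → q = p)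
    (HA : HasNeronModelAway R K E f) (g : R) (hgp : g ∉ p)
    (Rg : Type u) [CommRing Rg] [Algebra R Rg] [IsLocalization.Away g Rg] [Algebra Rg K]
    [IsScalarTower R Rg K]
    (Rp : Type u) [CommRing Rp] [Algebra R Rp] [IsLocalization.AtPrime Rp p] [Algebra Rp K]
    [IsScalarTower R Rp K] [Algebra Rg Rp] [IsScalarTower R Rg Rp] [IsScalarTower Rg Rp K]
    (Y : Over (Spec (.of Rg))) (hYsm : Smooth Y.hom) (hYsep : IsSeparated Y.hom)
    (hYqc : QuasiCompact Y.hom)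
    (HY : IsSchematicNeronModel Rp K ((Over.pullback (specOfAlgebraMap Rg Rp)).obj Y) E) :
    ∃ 𝒩 : Grp (Over (Spec (.of R))), IsNeronModel R K 𝒩.X E := by
  classical
  -- primes containing `f` are `𝔭`
  have hV : ∀ q : Ideal R, q.IsPrime → f ∈ q → q = p := fun q hq hfq =>
    huniq q (hq.isMaximal fun h => hf (by simpa [h] using hfq)) hfq
  have hg0 : g ≠ 0 := fun h => hgp (h ▸ p.zero_mem)
  have hinjK : Function.Injective (algebraMap R K) := IsFractionRing.injective R K
  have hunitK : ∀ {x : R}, x ≠ 0 → IsUnit (algebraMap R K x) := fun hx =>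
    isUnit_iff_ne_zero.mpr ((map_ne_zero_iff _ hinjK).mpr hx)
  -- the model `R_f` and the Néron model `N_f`
  let Rf := Localization.Away f
  letI : Algebra Rf K := (IsLocalization.Away.lift f (hunitK hf)).toAlgebra
  haveI : IsScalarTower R Rf K :=
    IsScalarTower.of_algebraMap_eq fun x => (IsLocalization.Away.lift_eq f (hunitK hf) x).symm
  obtain ⟨Nf, hNf⟩ := HA Rf
  -- the model `R_{fg} = R_f[1/g]` of `R[1/fg]`, an `R_g`-algebra
  let Rfg := Localization.Away (algebraMap R Rf g)
  have hgfK : IsUnit (algebraMap Rf K (algebraMap R Rf g)) := by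
    rw [← IsScalarTower.algebraMap_apply]; exact hunitK hg0
  letI : Algebra Rfg K := (IsLocalization.Away.lift (algebraMap R Rf g) hgfK).toAlgebra
  haveI : IsScalarTower Rf Rfg K :=
    IsScalarTower.of_algebraMap_eq (R := Rf) (S := Rfg) (A := K) fun x =>
      (IsLocalization.Away.lift_eq (algebraMap R Rf g) hgfK x).symm
  haveI : IsScalarTower R Rfg K :=
    IsScalarTower.of_algebraMap_eq (R := R) (S := Rfg) (A := K) fun x => by
      rw [IsScalarTower.algebraMap_apply R Rf Rfg x, ← IsScalarTower.algebraMap_apply Rf Rfg K,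
        ← IsScalarTower.algebraMap_apply R Rf K]
  have hgRfg : IsUnit (algebraMap R Rfg g) := by
    rw [IsScalarTower.algebraMap_apply R Rf Rfg]
    exact IsLocalization.Away.algebraMap_isUnit (algebraMap R Rf g)
  letI : Algebra Rg Rfg := (IsLocalization.Away.lift g hgRfg).toAlgebra
  haveI : IsScalarTower R Rg Rfg :=
    IsScalarTower.of_algebraMap_eq fun x => (IsLocalization.Away.lift_eq g hgRfg x).symm
  haveI : IsScalarTower Rg Rfg K := by
    refine IsScalarTower.of_algebraMap_eq' ?_
    apply IsLocalization.ringHom_ext (Submonoid.powers g)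
    rw [RingHom.comp_assoc, ← IsScalarTower.algebraMap_eq R Rg Rfg, ← IsScalarTower.algebraMap_eq,
      ← IsScalarTower.algebraMap_eq]
  haveI : IsLocalization.Away (algebraMap R Rg f) Rfg :=
    IsLocalization.Away.commutes (R := R) Rg Rf Rfg g f
  -- the two schemes over `R_{fg}` and their generic fibres
  haveI : IsOpenImmersion (specOfAlgebraMap Rg Rfg) :=
    IsOpenImmersion.of_isLocalization (algebraMap R Rg f)
  haveI : IsOpenImmersion (specOfAlgebraMap Rf Rfg) :=
    IsOpenImmersion.of_isLocalization (algebraMap R Rf g)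
  let Y' : Over (Spec (.of Rfg)) := (Over.pullback (specOfAlgebraMap Rg Rfg)).obj Y
  let Nf' : Over (Spec (.of Rfg)) := (Over.pullback (specOfAlgebraMap Rf Rfg)).obj Nf.X
  have hNf' : IsNeronModel Rfg K Nf' E := hNf.pullback_away (R' := Rfg) (algebraMap R Rf g)
  haveI : QuasiCompact Y'.hom := MorphismProperty.pullback_snd _ _ hYqc
  haveI : IsSeparated Y'.hom := MorphismProperty.pullback_snd _ _ hYsep
  haveI : Smooth Y'.hom := MorphismProperty.pullback_snd _ _ hYsm
  haveI : QuasiCompact Nf'.hom := hNf'.quasiCompact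
  haveI : IsSeparated Nf'.hom := hNf'.isSeparated
  haveI : Smooth Nf'.hom := hNf'.smooth
  -- generic fibre of `Y'`: `(Y ×_{R_g} R_{fg})_K ≅ Y_K ≅ (Y ×_{R_g} R_𝔭)_K ≅ E`
  obtain ⟨eY⟩ := HY.nonempty_iso
  let kY : (genericFibre Rfg K).obj Y' ≅ E :=
    pullbackObjIsoOfFac (specOfAlgebraMap Rg Rfg) (specGenericPoint Rfg K) (specGenericPoint Rg K)
        (specGenericPoint_comp_specOfAlgebraMap Rg K Rfg) Y ≪≫
      (pullbackObjIsoOfFac (specOfAlgebraMap Rg Rp) (specGenericPoint Rp K) (specGenericPoint Rg K)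
        (specGenericPoint_comp_specOfAlgebraMap Rg K Rp) Y).symm ≪≫ eY
  obtain ⟨kN, -⟩ := hNf'.exists_iso
  -- `K` is the localization of `R_{fg}` at the image of `R ∖ 𝔭`; compare over some `D(fgw)`
  haveI : IsLocalization ((p.primeCompl).map (algebraMap R Rfg)) K :=
    Literature.RingTheory.DedekindDomain.isLocalization_map_primeCompl_of_away p
      (f := f * g) (mul_ne_zero hf hg0) (p.mul_mem_right g hfp) Rfg K
  obtain ⟨⟨tv, tmem⟩, ⟨et⟩⟩ := LocApprox.exists_pullback_iso_of_pullback_iso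
    (S := p.primeCompl.map (algebraMap R Rfg)) (B := K) (P₁ := Y') (P₂ := Nf') (kY ≪≫ kN.symm)
  obtain ⟨w, hwp, hwt⟩ := Submonoid.mem_map.mp tmem
  subst hwt
  have hwp' : w ∉ p := hwp
  have hw0 : w ≠ 0 := fun h => hwp' (h ▸ p.zero_mem)
  have hgwp : g * w ∉ p := fun h => (‹p.IsMaximal›.isPrime.mem_or_mem h).elim hgp hwp'
  -- the models `L = R_{fg}[1/w]` of `R[1/fgw]` and `R_{gw} = R_g[1/w]` of `R[1/gw]`
  let L := Localization.Away (algebraMap R Rfg w)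
  let Rgw := Localization.Away (algebraMap R Rg w)
  -- maps to `K`
  have hwRfgK : IsUnit (algebraMap Rfg K (algebraMap R Rfg w)) := by
    rw [← IsScalarTower.algebraMap_apply]; exact hunitK hw0
  letI : Algebra L K := (IsLocalization.Away.lift (algebraMap R Rfg w) hwRfgK).toAlgebra
  haveI : IsScalarTower Rfg L K :=
    IsScalarTower.of_algebraMap_eq (R := Rfg) (S := L) (A := K) fun x =>
      (IsLocalization.Away.lift_eq (algebraMap R Rfg w) hwRfgK x).symm
  have hwRgK : IsUnit (algebraMap Rg K (algebraMap R Rg w)) := by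
    rw [← IsScalarTower.algebraMap_apply]; exact hunitK hw0
  letI : Algebra Rgw K := (IsLocalization.Away.lift (algebraMap R Rg w) hwRgK).toAlgebra
  haveI : IsScalarTower Rg Rgw K :=
    IsScalarTower.of_algebraMap_eq (R := Rg) (S := Rgw) (A := K) fun x =>
      (IsLocalization.Away.lift_eq (algebraMap R Rg w) hwRgK x).symm
  haveI : IsScalarTower R Rgw K :=
    IsScalarTower.of_algebraMap_eq (R := R) (S := Rgw) (A := K) fun x => by
      rw [IsScalarTower.algebraMap_apply R Rg Rgw x, ← IsScalarTower.algebraMap_apply Rg Rgw K,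
        ← IsScalarTower.algebraMap_apply R Rg K]
  -- `L` over `R_f`, `R_g`: towers
  have hRfL : ∀ x : Rf, algebraMap Rf L x = algebraMap Rfg L (algebraMap Rf Rfg x) := fun x =>
    IsScalarTower.algebraMap_apply Rf Rfg L x
  have hRgL : ∀ x : Rg, algebraMap Rg L x = algebraMap Rfg L (algebraMap Rg Rfg x) := fun x =>
    IsScalarTower.algebraMap_apply Rg Rfg L x
  haveI : IsScalarTower Rf L K :=
    IsScalarTower.of_algebraMap_eq (R := Rf) (S := L) (A := K) fun x => by
      rw [hRfL, ← IsScalarTower.algebraMap_apply Rfg L K, ← IsScalarTower.algebraMap_apply Rf Rfg K]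
  haveI : IsScalarTower R Rf L :=
    IsScalarTower.of_algebraMap_eq (R := R) (S := Rf) (A := L) fun x => by
      rw [hRfL, ← IsScalarTower.algebraMap_apply R Rf Rfg, ← IsScalarTower.algebraMap_apply R Rfg L]
  -- `L` over `R_{gw}`
  have hwL : IsUnit ((algebraMap Rg L : Rg →+* L) (algebraMap R Rg w)) := by
    rw [hRgL, ← IsScalarTower.algebraMap_apply R Rg Rfg]
    exact IsLocalization.Away.algebraMap_isUnit (S := L) (algebraMap R Rfg w)
  letI : Algebra Rgw L :=
    (IsLocalization.Away.lift (S := Rgw) (P := L) (algebraMap R Rg w) hwL).toAlgebra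
  haveI : IsScalarTower Rg Rgw L := by
    refine IsScalarTower.of_algebraMap_eq' (R := Rg) (S := Rgw) (A := L) ?_
    exact (IsLocalization.Away.lift_comp (S := Rgw) (P := L) (algebraMap R Rg w) hwL).symm
  haveI : IsScalarTower R Rgw L :=
    IsScalarTower.of_algebraMap_eq (R := R) (S := Rgw) (A := L) fun x => by
      rw [IsScalarTower.algebraMap_apply R Rg Rgw x, ← IsScalarTower.algebraMap_apply Rg Rgw L,
        hRgL, ← IsScalarTower.algebraMap_apply R Rg Rfg, ← IsScalarTower.algebraMap_apply R Rfg L]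
  haveI : IsScalarTower Rgw L K := by
    refine IsScalarTower.of_algebraMap_eq' ?_
    apply IsLocalization.ringHom_ext (Submonoid.powers (algebraMap R Rg w)) (S := Rgw)
    rw [RingHom.comp_assoc, ← IsScalarTower.algebraMap_eq Rg Rgw L, ← IsScalarTower.algebraMap_eq]
    ext x
    rw [RingHom.comp_apply, hRgL, ← IsScalarTower.algebraMap_apply Rfg L K,
      ← IsScalarTower.algebraMap_apply Rg Rfg K]
  -- `R_𝔭` over `R_{gw}`
  have hwRp : IsUnit (algebraMap Rg Rp (algebraMap R Rg w)) := by
    rw [← IsScalarTower.algebraMap_apply]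
    exact IsLocalization.map_units Rp ⟨w, hwp⟩
  letI : Algebra Rgw Rp := (IsLocalization.Away.lift (algebraMap R Rg w) hwRp).toAlgebra
  haveI : IsScalarTower Rg Rgw Rp :=
    IsScalarTower.of_algebraMap_eq (R := Rg) (S := Rgw) (A := Rp) fun x =>
      (IsLocalization.Away.lift_eq (algebraMap R Rg w) hwRp x).symm
  haveI : IsScalarTower R Rgw Rp :=
    IsScalarTower.of_algebraMap_eq (R := R) (S := Rgw) (A := Rp) fun x => by
      rw [IsScalarTower.algebraMap_apply R Rg Rgw x, ← IsScalarTower.algebraMap_apply Rg Rgw Rp,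
        ← IsScalarTower.algebraMap_apply R Rg Rp]
  -- the localization instances: `L = R_f[1/gw] = R_{gw}[1/f]`
  haveI : IsLocalization.Away (algebraMap R Rf (g * w)) L := by
    have : IsLocalization.Away (algebraMap Rf Rfg (algebraMap R Rf w)) L := by
      rw [← IsScalarTower.algebraMap_apply]
      exact inferInstanceAs (IsLocalization.Away (algebraMap R Rfg w) L)
    rw [map_mul]
    exact IsLocalization.Away.mul' (R := Rf) Rfg L (algebraMap R Rf g) (algebraMap R Rf w)
  haveI : IsLocalization.Away (algebraMap R Rgw f) L :=
    IsLocalization.Away.commutes (R := R) Rgw Rf L (g * w) f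
  -- the smooth piece over `D(gw)` and its restriction to `R_𝔭`
  haveI : IsOpenImmersion (specOfAlgebraMap Rg Rgw) :=
    IsOpenImmersion.of_isLocalization (algebraMap R Rg w)
  let Y₁ : Over (Spec (.of Rgw)) := (Over.pullback (specOfAlgebraMap Rg Rgw)).obj Y
  have hY₁sm : Smooth Y₁.hom := MorphismProperty.pullback_snd _ _ hYsm
  have hY₁sep : IsSeparated Y₁.hom := MorphismProperty.pullback_snd _ _ hYsep
  have hY₁qc : QuasiCompact Y₁.hom := MorphismProperty.pullback_snd _ _ hYqc
  have hfacp : specOfAlgebraMap Rgw Rp ≫ specOfAlgebraMap Rg Rgw = specOfAlgebraMap Rg Rp := by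
    simp only [specOfAlgebraMap, ← Spec.map_comp, ← CommRingCat.ofHom_comp,
      ← IsScalarTower.algebraMap_eq Rg Rgw Rp]
  have HY₁ : IsSchematicNeronModel Rp K ((Over.pullback (specOfAlgebraMap Rgw Rp)).obj Y₁) E :=
    HY.of_iso_left (pullbackObjIsoOfFac (specOfAlgebraMap Rg Rgw) (specOfAlgebraMap Rgw Rp)
      (specOfAlgebraMap Rg Rp) hfacp Y).symm
  -- the gluing isomorphism over `L`
  have h₁ : specOfAlgebraMap Rgw L ≫ specOfAlgebraMap Rg Rgw = specOfAlgebraMap Rg L := by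
    simp only [specOfAlgebraMap, ← Spec.map_comp, ← CommRingCat.ofHom_comp,
      ← IsScalarTower.algebraMap_eq Rg Rgw L]
  have h₂ : specOfAlgebraMap Rfg L ≫ specOfAlgebraMap Rg Rfg = specOfAlgebraMap Rg L := by
    simp only [specOfAlgebraMap, ← Spec.map_comp, ← CommRingCat.ofHom_comp]
  have h₃ : specOfAlgebraMap Rfg L ≫ specOfAlgebraMap Rf Rfg = specOfAlgebraMap Rf L := by
    simp only [specOfAlgebraMap, ← Spec.map_comp, ← CommRingCat.ofHom_comp]
  let ψ : (Over.pullback (specOfAlgebraMap Rgw L)).obj Y₁ ≅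
      (Over.pullback (specOfAlgebraMap Rf L)).obj Nf.X :=
    pullbackObjIsoOfFac (specOfAlgebraMap Rg Rgw) (specOfAlgebraMap Rgw L) (specOfAlgebraMap Rg L)
        h₁ Y ≪≫
      (pullbackObjIsoOfFac (specOfAlgebraMap Rg Rfg) (specOfAlgebraMap Rfg L)
        (specOfAlgebraMap Rg L) h₂ Y).symm ≪≫
      et ≪≫
      pullbackObjIsoOfFac (specOfAlgebraMap Rf Rfg) (specOfAlgebraMap Rfg L) (specOfAlgebraMap Rf L)
        h₃ Nf.X
  exact exists_isNeronModel_of_iso_glue_atPrime E f (g * w) p hV hgwp Rgw Rf L Rp Y₁ hY₁sm hY₁sep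
    hY₁qc HY₁ Nf.X hNf.isSchematicNeronModel ψ

/-- **The one-bad-prime gluing from descent of the local Néron model** (assembly of
`exists_isNeronModel_of_away_of_localModel` with its remaining input). In the situation of the
named fact `exists_isNeronModel_of_away_of_atPrime_of_unique` of `NeronModelGluing` (`R` Dedekind,
`0 ≠ f ∈ 𝔭`, `𝔭` the only maximal ideal containing `f`, Néron models of `E` over the models of
`R[1/f]` and of `R_𝔭`), suppose that smooth separated quasi-compact schemes over the local rings of
`R` at `𝔭` extend to smooth separated quasi-compact schemes over open neighbourhoods `D(g)` of `𝔭`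
— the hypothesis `hD`, which is EGA IV₃ Thm. 8.8.2 (ii) with Prop. 8.10.5 (v) and EGA IV₄
Prop. 17.7.8 (ii) for the limit `R_𝔭 = colim_{g ∉ 𝔭} R[1/g]` (Görtz–Wedhorn I, Thm. 10.66 and
(10.13)), not yet available in this tree or in Mathlib. Then `E` has a Néron model over `R`: apply
`hD` to the Néron model over `R_𝔭` and glue by `exists_isNeronModel_of_away_of_localModel`.
[cite: BLRNeronModels1990, §1.4 (local-to-global passage, one closed point)]
[cite: EGAIV3, Thm. 8.8.2 (ii) and Prop. 8.10.5 (v)] [cite: EGAIV4, Prop. 17.7.8 (ii)] -/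
theorem exists_isNeronModel_of_away_of_atPrime_of_localModels (f : R) (hf : f ≠ 0) (p : Ideal R)
    [p.IsMaximal] (hfp : f ∈ p) (huniq : ∀ q : Ideal R, q.IsMaximal → f ∈ q → q = p)
    (HA : HasNeronModelAway R K E f) (HP : HasNeronModelAtPrime R K E p)
    (hD : ∀ (Rp : Type u) [CommRing Rp] [Algebra R Rp] [IsLocalization.AtPrime Rp p]
      (X : Over (Spec (.of Rp))), Smooth X.hom → IsSeparated X.hom → QuasiCompact X.hom →
      ∃ g : R, g ∉ p ∧ ∀ (Rg : Type u) [CommRing Rg] [Algebra R Rg] [IsLocalization.Away g Rg]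
        [Algebra Rg Rp] [IsScalarTower R Rg Rp],
        ∃ Y : Over (Spec (.of Rg)), Smooth Y.hom ∧ IsSeparated Y.hom ∧ QuasiCompact Y.hom ∧
          Nonempty ((Over.pullback (specOfAlgebraMap Rg Rp)).obj Y ≅ X)) :
    ∃ 𝒩 : Grp (Over (Spec (.of R))), IsNeronModel R K 𝒩.X E := by
  have hinjK : Function.Injective (algebraMap R K) := IsFractionRing.injective R K
  -- the model `R_𝔭` and the Néron model over it
  have hpc : ∀ y : p.primeCompl, IsUnit (algebraMap R K y) := fun y =>
    isUnit_iff_ne_zero.mpr ((map_ne_zero_iff _ hinjK).mpr fun h => y.2 (h ▸ p.zero_mem))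
  let Rp := Localization.AtPrime p
  letI : Algebra Rp K := (IsLocalization.lift (M := p.primeCompl) hpc).toAlgebra
  haveI : IsScalarTower R Rp K :=
    IsScalarTower.of_algebraMap_eq fun x => (IsLocalization.lift_eq hpc x).symm
  obtain ⟨Np, hNp⟩ := HP Rp
  obtain ⟨g, hgp, H⟩ := hD Rp Np.X hNp.smooth hNp.isSeparated hNp.quasiCompact
  -- the model `R_g`, an algebra over which `R_𝔭` and `K` are
  have hg0 : g ≠ 0 := fun h => hgp (h ▸ p.zero_mem)
  let Rg := Localization.Away g
  have hgK : IsUnit (algebraMap R K g) := isUnit_iff_ne_zero.mpr ((map_ne_zero_iff _ hinjK).mpr hg0)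
  letI : Algebra Rg K := (IsLocalization.Away.lift g hgK).toAlgebra
  haveI : IsScalarTower R Rg K :=
    IsScalarTower.of_algebraMap_eq fun x => (IsLocalization.Away.lift_eq g hgK x).symm
  have hgp' : IsUnit (algebraMap R Rp g) := IsLocalization.map_units Rp (⟨g, hgp⟩ : p.primeCompl)
  letI : Algebra Rg Rp := (IsLocalization.Away.lift g hgp').toAlgebra
  haveI : IsScalarTower R Rg Rp :=
    IsScalarTower.of_algebraMap_eq fun x => (IsLocalization.Away.lift_eq g hgp' x).symm
  haveI : IsScalarTower Rg Rp K := by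
    refine IsScalarTower.of_algebraMap_eq' ?_
    apply IsLocalization.ringHom_ext (Submonoid.powers g)
    rw [RingHom.comp_assoc, ← IsScalarTower.algebraMap_eq R Rg Rp, ← IsScalarTower.algebraMap_eq,
      ← IsScalarTower.algebraMap_eq]
  obtain ⟨Y, hYsm, hYsep, hYqc, ⟨eY⟩⟩ := H Rg
  exact exists_isNeronModel_of_away_of_localModel E f hf p hfp huniq HA g hgp Rg Rp Y hYsm hYsep
    hYqc (hNp.isSchematicNeronModel.of_iso_left eY.symm)

end OnePrime

end Literature.NumberTheory.EllipticCurves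

end
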